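import Mathlib.Data.Real.Basic
import Mathlib.Data.Fintype.Fin
import Mathlib.Tactic.FinCases
import HarnessLib

/-!
# Row RB-N1b tail lemma (dim 50) — the kept vector as a sequence `ext x : ℕ → ℝ` (numeral lookups) and the two hypotheses of
`QuadFormEval.dotProduct_mulVec_eq_rowsEval` (GENERATED by pub-turb-cert gen 8 (prover-pub-turb-cert-g8-0) running the gen-7 tool `emit_pieces_v21.py N1bG2n16`; tool file, no mathematical content).

HONEST FRAMING: rigorous bounds for the stated PDE and boundary conditions; no claim about physical turbulence beyond the bound.
-/

set_option linter.style.longLine false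

noncomputable section

namespace Summit.NavierStokesRegularity.TurbBounds.TailN1bG2n16

/-- the kept vector `x : Fin 50 → ℝ` as a sequence (`x_k` for `k < 50`, `0` beyond), by numeral lookup -/
def ext (x : Fin 50 → ℝ) : ℕ → ℝ
  | 0 => x 0
  | 1 => x 1
  | 2 => x 2
  | 3 => x 3
  | 4 => x 4
  | 5 => x 5
  | 6 => x 6
  | 7 => x 7
  | 8 => x 8
  | 9 => x 9
  | 10 => x 10
  | 11 => x 11
  | 12 => x 12
  | 13 => x 13
  | 14 => x 14
  | 15 => x 15
  | 16 => x 16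
  | 17 => x 17
  | 18 => x 18
  | 19 => x 19
  | 20 => x 20
  | 21 => x 21
  | 22 => x 22
  | 23 => x 23
  | 24 => x 24
  | 25 => x 25
  | 26 => x 26
  | 27 => x 27
  | 28 => x 28
  | 29 => x 29
  | 30 => x 30
  | 31 => x 31
  | 32 => x 32
  | 33 => x 33
  | 34 => x 34
  | 35 => x 35
  | 36 => x 36
  | 37 => x 37
  | 38 => x 38
  | 39 => x 39
  | 40 => x 40
  | 41 => x 41
  | 42 => x 42
  | 43 => x 43
  | 44 => x 44
  | 45 => x 45
  | 46 => x 46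
  | 47 => x 47
  | 48 => x 48
  | 49 => x 49
  | _ => 0

/-- `ext x` extends `x`. -/
theorem ext_val (x : Fin 50 → ℝ) : ∀ i : Fin 50, ext x i.val = x i := by
  intro i
  fin_cases i <;> rfl

/-- `ext x` vanishes from `50` on. -/
theorem ext_zero (x : Fin 50 → ℝ) : ∀ k, 50 ≤ k → ext x k = 0 := by
  intro k hk
  obtain ⟨j, rfl⟩ : ∃ j, k = j + 50 := ⟨k - 50, by omega⟩
  rfl

end Summit.NavierStokesRegularity.TurbBounds.TailN1bG2n16

end
-- build-lane re-dispatch touch 2026-08-24 (lead decision 262/E1); no declaration change
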